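import Summits.CriticalPhenomena.SAWScalingLimit.Theses.SAWChargeContinuation
import Summits.CriticalPhenomena.SAWScalingLimit.Theorems.SAWChargeContinuationVitaliTransportAnalysis

/-!
# `SAWChargeContinuation.VitaliTransport` (stmt-CriticalPhenomena-4925) — proved

Route `SAWChargeContinuation` of `CriticalPhenomena/SAWScalingLimit`, support item

  `VitaliTransport : WindowAvoidanceLaw → ChargeAnalyticity → SAWAvoidanceLaw`.

Fix the data `(D, D′, a, b, φ, Φ, d)`. The functions `g_δ` of `ChargeAnalyticity` are
holomorphic on an open `N ⊇ [0,1]` and uniformly bounded by `C`, and on the real window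
`[1-ε, 1]` they converge (by `WindowAvoidanceLaw`, since `y = y_W` there) to `d^{α(s)}`. The
transport lemma of part I (`SAWChargeContinuationVitaliTransportAnalysis.lean`: Vitali's
convergence theorem on the component of `N ∩ W` containing `[0,1]`, `W` a complex neighbourhood
of `[0,1]` carrying the holomorphic continuation `H` of `s ↦ d^{α(s)}`, plus the identity theorem
and the subsequence principle) gives `g_δ(0) → H(0) = d^{α(0)} = d^{5/8}`. Finally `g_δ(0)` is the
ratio of the `x_c^{|γ|}`-sums over the SAWs of `D_δ` (walks using only closed mesh edges of `D′`
between mesh vertices of `D′` in the numerator — the route's sub-graph `G(D, D′, δ)` —, all walks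
in the denominator, since `G(D, D, δ) ⊇ D_δ`), i.e. the `SAW.law`-probability of the avoidance
event of `SAWAvoidanceLaw` (`ratio_zero_eq_law`; the SAW space of the bounded domain `D` is finite
for `δ > 0`, `finite_domainSAW`, and both sides follow the junk convention `Z_δ = 0 ↦ 0`).

## References

* G. F. Lawler, O. Schramm, W. Werner, *Conformal restriction: the chordal case*, J. Amer. Math.
  Soc. 16 (2003), Thm. 6.1 (the value `Φ'_A(0)^{5/8}`).
* M. J. Kozdron, G. F. Lawler, *The configurational measure on mutually avoiding SLE paths*,
  Fields Inst. Commun. 50 (2007), §6 (the `λ`-SAW family, `s = 0` is the SAW).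
-/

noncomputable section

open Filter Set Metric Topology Complex
open scoped Classical

namespace Summit.CriticalPhenomena.SAWScalingLimit.Theorems

namespace SAWChargeContinuationVitali

/-! ## Lattice bookkeeping: the ratio at `s = 0` is the SAW probability -/

open MeasureTheory Literature.Probability.LatticeModels Literature.Probability.RandomPlanarGeometry

variable {Ω : Set ℂ} {δ : ℝ} {u v : Site 2}

-- adapted from Summits/CriticalPhenomena/SAWScalingLimit/Theorems/SAWLoopFugacityFlowAssembly.lean
/-- The vertices of a walk of `Ω_δ` are its starting point or sites of `Ω_δ` (every edge of
`discreteDomainGraph Ω δ` joins two sites of `meshDomain Ω δ`). [folklore] -/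
theorem mem_support_walk (p : (discreteDomainGraph Ω δ).Walk u v) :
    ∀ w ∈ p.support, w = u ∨ w ∈ meshDomain Ω δ := by
  induction p with
  | nil =>
    intro w hw
    rw [SimpleGraph.Walk.support_nil, List.mem_singleton] at hw
    exact Or.inl hw
  | cons h p ih =>
    intro w hw
    rw [SimpleGraph.Walk.support_cons, List.mem_cons] at hw
    rcases hw with rfl | hw
    · exact Or.inl rfl
    · rcases ih w hw with rfl | hw'
      · exact Or.inr (discreteDomainGraph_adj_iff.1 h).2.2
      · exact Or.inr hw'

-- adapted from Summits/CriticalPhenomena/SAWScalingLimit/Theorems/SAWLoopFugacityFlowAssembly.lean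
/-- The support of a SAW of `Ω_δ` determines it. [folklore] -/
theorem walk_support_injective :
    Function.Injective fun γ : SAW.DomainSAW Ω δ u v => γ.walk.support := by
  rintro ⟨p, hp⟩ ⟨q, hq⟩ h
  simp only at h
  have := SimpleGraph.Walk.support_injective h
  subst this
  rfl

-- adapted from Summits/CriticalPhenomena/SAWScalingLimit/Theorems/SAWLoopFugacityFlowAssembly.lean
/-- For a bounded domain and a positive mesh there are finitely many SAWs of `Ω_δ` between two
given sites: their supports are duplicate-free lists over the finite set `{u} ∪ Ω_δ`.
[folklore] -/
theorem finite_domainSAW (hΩ : Bornology.IsBounded Ω) (hδ : 0 < δ) (u v : Site 2) :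
    Finite (SAW.DomainSAW Ω δ u v) := by
  set S : Set (Site 2) := insert u (meshDomain Ω δ) with hSdef
  have hfin : S.Finite := (meshDomain_finite hΩ hδ).insert u
  haveI : Fintype ↥S := hfin.fintype
  have hsupp : ∀ (γ : SAW.DomainSAW Ω δ u v), ∀ w ∈ γ.walk.support, w ∈ S := by
    intro γ w hw
    rcases mem_support_walk γ.walk w hw with rfl | h
    · exact Set.mem_insert _ _
    · exact Set.mem_insert_of_mem _ h
  let f : SAW.DomainSAW Ω δ u v → {l : List ↥S // l.length ≤ Fintype.card ↥S} :=
    fun γ => ⟨γ.walk.support.pmap (fun w hw => ⟨w, hw⟩) (hsupp γ), by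
      rw [List.length_pmap]
      have hnd : (γ.walk.support.pmap (fun w hw => (⟨w, hw⟩ : ↥S)) (hsupp γ)).Nodup := by
        refine List.Nodup.pmap ?_ γ.isPath.support_nodup
        intro a ha b hb h
        exact congrArg Subtype.val h
      have := hnd.length_le_card
      rwa [List.length_pmap] at this⟩
  haveI : Finite {l : List ↥S // l.length ≤ Fintype.card ↥S} :=
    (List.finite_length_le _ _).to_subtype
  refine Finite.of_injective f fun γ γ' h => ?_
  apply walk_support_injective
  have h' :=
    congrArg (fun l : {l : List ↥S // l.length ≤ Fintype.card ↥S} => l.1.map Subtype.val) h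
  simpa [f, List.map_pmap] using h'

/-- The critical fugacity `x_c = μ⁻¹` is nonnegative (`μ` is an infimum of nonnegative reals).
[folklore] -/
theorem criticalFugacity_nonneg : 0 ≤ SAW.criticalFugacity := by
  unfold SAW.criticalFugacity SAW.connectiveConstant
  exact inv_nonneg.2 (Real.iInf_nonneg fun n => Real.rpow_nonneg (Nat.cast_nonneg _) _)

/-- On the finite SAW space the critical weight of an event is the finite sum of its atoms
`x_c^{|γ|}`. [folklore] -/
theorem weight_apply_eq_sum [Fintype (SAW.DomainSAW Ω δ u v)] (S : Set (SAW.DomainSAW Ω δ u v)) :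
    SAW.weight Ω δ u v S =
      ∑ γ, if γ ∈ S then ENNReal.ofReal (SAW.criticalFugacity ^ γ.length) else 0 := by
  rw [SAW.weight, Measure.sum_apply _ MeasurableSpace.measurableSet_top, tsum_fintype]
  refine Finset.sum_congr rfl fun γ _ => ?_
  rw [Measure.smul_apply, Measure.dirac_apply' _ MeasurableSpace.measurableSet_top, smul_eq_mul,
    Set.indicator_apply]
  split_ifs <;> simp

/-- The real mass of an event under the critical weight, as a finite sum. [folklore] -/
theorem toReal_weight_eq_sum [Fintype (SAW.DomainSAW Ω δ u v)] (S : Set (SAW.DomainSAW Ω δ u v)) :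
    (SAW.weight Ω δ u v S).toReal =
      ∑ γ, if γ ∈ S then SAW.criticalFugacity ^ γ.length else 0 := by
  rw [weight_apply_eq_sum, ENNReal.toReal_sum (fun γ _ => by split_ifs <;> simp)]
  refine Finset.sum_congr rfl fun γ _ => ?_
  split_ifs
  · exact ENNReal.toReal_ofReal (pow_nonneg criticalFugacity_nonneg _)
  · simp

/-- The SAW probability of an event as a ratio of finite `x_c^{|γ|}`-sums (value `0` under the
junk convention `Z_δ = 0`, on both sides). [folklore] -/
theorem toReal_law_apply [Fintype (SAW.DomainSAW Ω δ u v)] (S : Set (SAW.DomainSAW Ω δ u v)) :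
    (SAW.law Ω δ u v S).toReal =
      (∑ γ : SAW.DomainSAW Ω δ u v, SAW.criticalFugacity ^ γ.length)⁻¹ *
        ∑ γ, if γ ∈ S then SAW.criticalFugacity ^ γ.length else 0 := by
  rw [SAW.law, Measure.smul_apply, smul_eq_mul, ENNReal.toReal_mul, ENNReal.toReal_inv,
    toReal_weight_eq_sum, toReal_weight_eq_sum]
  simp

/-- Adjacency in the sub-graph `G(Ω, Ω', δ)` of the route (edges of `Ω_δ` that are also closed
edges of the mesh graph of `Ω'` between mesh vertices of `Ω'`), for a dart of `Ω_δ`: it is the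
avoidance condition of `SAWAvoidanceLaw`. [folklore] -/
theorem fromRel_dart_adj_iff (Ω' : Set ℂ) (e : (discreteDomainGraph Ω δ).Dart) :
    (SimpleGraph.fromRel fun x y => (discreteDomainGraph Ω δ).Adj x y ∧ (meshGraph Ω' δ).Adj x y ∧
        x ∈ meshVertices Ω' δ ∧ y ∈ meshVertices Ω' δ).Adj e.fst e.snd ↔
      (meshGraph Ω' δ).Adj e.fst e.snd ∧ e.fst ∈ meshVertices Ω' δ ∧
        e.snd ∈ meshVertices Ω' δ := by
  rw [SimpleGraph.fromRel_adj]
  constructor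
  · rintro ⟨-, h | h⟩
    · exact h.2
    · exact ⟨h.2.1.symm, h.2.2.2, h.2.2.1⟩
  · intro h
    exact ⟨e.adj.ne, Or.inl ⟨e.adj, h⟩⟩

/-- For `Ω' = Ω` the sub-graph condition holds for every dart of `Ω_δ` (`Ω_δ` is a subgraph of
the mesh graph on mesh vertices), so the denominator of the route's ratio is the full partition
function. [folklore] -/
theorem fromRel_dart_adj_self (e : (discreteDomainGraph Ω δ).Dart) :
    (SimpleGraph.fromRel fun x y => (discreteDomainGraph Ω δ).Adj x y ∧ (meshGraph Ω δ).Adj x y ∧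
        x ∈ meshVertices Ω δ ∧ y ∈ meshVertices Ω δ).Adj e.fst e.snd := by
  rw [fromRel_dart_adj_iff]
  have h := discreteDomainGraph_adj_iff.1 e.adj
  exact ⟨h.1, meshDomain_subset_meshVertices _ _ h.2.1, meshDomain_subset_meshVertices _ _ h.2.2⟩

/-- **The ratio at the SAW endpoint `s = 0`, `y = x_c`.** For a bounded domain and `δ > 0`, the
route's ratio `Z(Ω_δ|Ω'; 0, x_c) / Z(Ω_δ; 0, x_c)` of `x_c^{|γ|}`-sums is the `SAW.law`-probability
that the walk uses only closed mesh edges of `Ω'` between mesh vertices of `Ω'`. [folklore] -/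
theorem ratio_zero_eq_law (hΩ : Bornology.IsBounded Ω) (hδ : 0 < δ) (Ω' : Set ℂ) (u v : Site 2) :
    (∑' γ : SAW.DomainSAW Ω δ u v,
        if (∀ e ∈ γ.walk.darts, (SimpleGraph.fromRel fun x y => (discreteDomainGraph Ω δ).Adj x y ∧
          (meshGraph Ω' δ).Adj x y ∧ x ∈ meshVertices Ω' δ ∧ y ∈ meshVertices Ω' δ).Adj
            e.fst e.snd)
        then (SAW.criticalFugacity : ℂ) ^ γ.length else 0) /
      (∑' γ : SAW.DomainSAW Ω δ u v,
        if (∀ e ∈ γ.walk.darts, (SimpleGraph.fromRel fun x y => (discreteDomainGraph Ω δ).Adj x y ∧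
          (meshGraph Ω δ).Adj x y ∧ x ∈ meshVertices Ω δ ∧ y ∈ meshVertices Ω δ).Adj
            e.fst e.snd)
        then (SAW.criticalFugacity : ℂ) ^ γ.length else 0) =
    (((SAW.law Ω δ u v {γ | ∀ e ∈ γ.walk.darts, (meshGraph Ω' δ).Adj e.fst e.snd ∧
        e.fst ∈ meshVertices Ω' δ ∧ e.snd ∈ meshVertices Ω' δ}).toReal : ℝ) : ℂ) := by
  haveI := finite_domainSAW hΩ hδ u v
  haveI : Fintype (SAW.DomainSAW Ω δ u v) := Fintype.ofFinite _
  rw [tsum_fintype, tsum_fintype, toReal_law_apply, ← div_eq_inv_mul, ofReal_div, ofReal_sum,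
    ofReal_sum]
  congr 1
  · refine Finset.sum_congr rfl fun γ _ => ?_
    simp only [fromRel_dart_adj_iff, Set.mem_setOf_eq]
    split_ifs <;> simp
  · refine Finset.sum_congr rfl fun γ _ => ?_
    rw [if_pos fun e _ => fromRel_dart_adj_self e]
    push_cast
    rfl

end SAWChargeContinuationVitali

/-! ## The item -/

open MeasureTheory Literature.Probability.LatticeModels Literature.Probability.RandomPlanarGeometry
  SAWChargeContinuationVitali Summit.CriticalPhenomena.SAWScalingLimit.Theses.SAWChargeContinuation

/-- **`VitaliTransport`** (item stmt-CriticalPhenomena-4925 of route SAWChargeContinuation):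
`WindowAvoidanceLaw → ChargeAnalyticity → SAWAvoidanceLaw`. Given the window law (P) with
`(ε, y_W)` and the analyticity package (U) it produces — an open `N ⊇ [0,1]`, a holomorphic `y`
with `y = y_W` on `[1-ε, 1]` and `y(0) = x_c`, and for each `(D, D', a, b)` eventually-in-`δ`
holomorphic `g_δ` on `N`, bounded by `C`, with `g_δ(t) = Z(D_δ|D'; t, y(t)) / Z(D_δ; t, y(t))` on
`[0,1]` — fix restriction data `(φ, Φ, d)`: on the window `g_δ(t) → d^{α(t)}` by (P), so by the
transport lemma (Vitali + identity theorem, with the continuation of `d^{α}` near `[0,1]`)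
`g_δ(0) → d^{α(0)} = d^{5/8}`; and `g_δ(0)` is the ratio of `x_c^{|γ|}`-sums, i.e. the
`SAW.law`-probability of the avoidance event (`ratio_zero_eq_law`).
[cite: LawlerSchrammWerner2003Restriction, Thm 6.1 (the value d^{5/8})] -/
theorem chargeContinuation_vitaliTransport_proof : VitaliTransport := by
  intro hP hU
  dsimp only [WindowAvoidanceLaw] at hP
  dsimp only [ChargeAnalyticity] at hU
  dsimp only [SAWAvoidanceLaw]
  obtain ⟨ε, hε, yW, hyW1, hwin⟩ := hP
  obtain ⟨N, hNo, -, hN01, y, -, hyW, hy0, hg⟩ := hU ε yW hε ⟨hyW1, hwin⟩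
  intro D D' hDD' a b hab φ hφ Φ d hΦ hd
  obtain ⟨C, hgev⟩ := hg D D' hDD' a b hab
  obtain ⟨W, H, hWo, hW01, hH, hHt⟩ := exists_continuation_rpow_alpha d
  have hε1 : 1 - ε < 1 := by linarith
  have key := tendsto_at_zero_of_tendsto_on_window hNo hN01 hWo hW01 hH hgev hε1 ?_
  · -- the limit value and the ratio at `s = 0`
    have hH0 : H 0 = ((d ^ (5 / 8 : ℝ) : ℝ) : ℂ) := by
      rw [← ofReal_zero, hHt 0 ⟨le_rfl, zero_le_one⟩, alpha_zero]
    rw [hH0] at key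
    have key' : Tendsto (fun δ => (((SAW.law D.carrier δ (a δ) (b δ)
        {γ | ∀ e ∈ γ.walk.darts, (meshGraph D'.carrier δ).Adj e.fst e.snd ∧
          e.fst ∈ meshVertices D'.carrier δ ∧ e.snd ∈ meshVertices D'.carrier δ}).toReal : ℝ) : ℂ))
        (𝓝[>] 0) (𝓝 (((d ^ (5 / 8 : ℝ) : ℝ)) : ℂ)) := by
      refine key.congr' ?_
      filter_upwards [self_mem_nhdsWithin] with δ hδ
      rw [ofReal_zero, hy0]
      simp only [zero_mul, Complex.exp_zero, mul_one]
      exact ratio_zero_eq_law D.isBounded hδ D'.carrier (a δ) (b δ)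
    have := (continuous_re.tendsto _).comp key'
    simpa [Function.comp_def] using this
  · intro t ht ht01
    rw [hyW t ⟨ht.1.le, ht.2.le⟩, hHt t ht01]
    exact (hwin t ⟨ht.1.le, ht.2.le⟩).2 D D' hDD' a b hab φ hφ Φ d hΦ hd

end Summit.CriticalPhenomena.SAWScalingLimit.Theorems
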